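import Literature.Probability.RandomPlanarGeometry.RadialBesselExit
import Literature.Probability.RandomPlanarGeometry.RadialBesselODE
import Literature.Probability.RandomPlanarGeometry.SLERealFlowGenerator
import Literature.Probability.RandomPlanarGeometry.SLEOnePointSwallowingProofs
import Literature.Analysis.FunctionSpaces.ItoFormulaProofs
import HarnessLib

/-!
# The radial Bessel process of SLE_κ: Itô-process structure and the generator martingales

Topic `Probability/RandomPlanarGeometry`; theorems and two auxiliary definitions (`genDrift`,
`expClock`), sequel of `RadialBesselFlow`, `RadialBesselExit`, `RadialBesselODE`. We specialise the
radial Bessel flow to the SLE_κ driving function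
`U = √κ B` on the canonical Wiener space: the level-`n` truncated flow
`Y = argLevel (sleDriving κ) … n θ` solves, for **every** path and all times,
`Yₜ = θ + ∫₀ᵗ cotTrunc δₙ (Y_s/2) ds - √κ Bₜ`, and agrees with LSW's
`Yₜ^θ = -i log gₜ(e^{iθ}) - √κ Bₜ`, `dYₜ = cot(Yₜ/2) dt - √κ dBₜ` (LSW (2002), (2.9)–(2.11); Lawler
(2005), (6.12)–(6.13), (1.16)) up to its exit time `σₙ` from `(2δₙ, 2π - 2δₙ)`. We prove:

* `isItoProcess_stoppedProcess_sleArgLevel` — **the stopped flow `Y^{σ}` is an Itô process**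
  driven by the canonical Brownian motion, with drift `𝟙_{s ≤ σ} cotTrunc δₙ (Y_s/2)` and
  diffusion coefficient `𝟙_{s ≤ σ} (-√κ)`, for any stopping time `σ` of the raw Brownian
  filtration (LSW (2.11) / Lawler (6.13) as an SDE, localised);
* `martingale_expGenerator_sleArgLevel` — **the generator martingales with exponential weight**:
  for `F ∈ C²(ℝ)` and `μ ∈ ℝ`, with `Λ_μ F := (κ/2) F'' + cot(·/2) F' + μ F` and `σ = σₙ` the
  exit time of the level-`n` flow `V = Y^{σₙ}` from `(2δₙ, 2π - 2δₙ)` (start inside),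
  `e^{μ (t ∧ σ)} F(V_t) - ∫₀ᵗ 𝟙_{s ≤ σ} e^{μ s} (Λ_μ F)(V_s) ds` is a martingale. This is the Itô
  step "By Itô's formula … `dh(Yₜ, s - t) = (κ/2 ∂²_θ h + cot(θ/2) ∂_θ h - ∂ₛh) dt - √κ ∂_θ h dBₜ`"
  of LSW (2002), proof of Lemma 2.2 (p. 6), in the separated-variables form
  `h(θ, t) = e^{μ t} F(θ)` used for `H(θ, t) = sin(θ/4)^q e^{-λ t}` (p. 7) and in Lawler
  (2005), Lemma 1.31 ("Itô's formula shows that `M_t := e^{λt} e^{-bF_t} φ₀(X_t)` is a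
  martingale"). The exponential of the *stopped* clock is produced from Itô's formula at
  deterministic times by the observation that after `σ` the stopped process is frozen, so the
  post-`σ` drift `μ e^{μ s} F(V_σ)` integrates to `F(V_σ)(e^{μ t} - e^{μ σ})` and cancels
  (`integral_postExit_drift`);
* `integral_expClock_mul_eq` — its expectation form
  `E[e^{μ(t∧σ)} F(V_t)] = F(θ) + E[∫₀ᵗ 𝟙_{s≤σ} e^{μs} (Λ_μ F)(V_s) ds]`, with the eigenfunction
  and supersolution corollaries `integral_expClock_mul_eq_self` (`Λ_μ F = 0` on
  `[2δₙ, 2π - 2δₙ]` ⟹ `E[e^{μ(t∧σ)} F(V_t)] = F(θ)`) and `integral_expClock_mul_le_self`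
  (`Λ_μ F ≤ 0` there ⟹ `≤ F(θ)`), the optional-stopping inputs of Lawler's Prop. 1.30 /
  Lemma 1.31 pattern for this diffusion.

## References

* G. F. Lawler, O. Schramm, W. Werner, *One-arm exponent for critical 2D percolation*, Electron.
  J. Probab. 7 (2002), no. 2, §2: (2.9)–(2.11), proof of Lemma 2.2 (p. 6), `H` (p. 7).
  [LawlerSchrammWernerEJP2002]
* G. F. Lawler, *Conformally Invariant Processes in the Plane*, AMS (2005): §1.11 (1.16),
  Prop. 1.30, Lemma 1.31; §6.4 (6.12)–(6.13). [Lawler2005]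
* D. Revuz, M. Yor, *Continuous Martingales and Brownian Motion* (1999), Ch. IV, Thm (3.3),
  Prop. (2.5).
-/

noncomputable section

open MeasureTheory ProbabilityTheory Filter Topology Set
open scoped NNReal ENNReal

namespace Literature.Probability.RandomPlanarGeometry

namespace RadialLoewner

open Literature.Probability.Process Literature.Analysis.FunctionSpaces

/-! ### The radial Bessel flow of SLE_κ: level-`n` truncations -/

/-- The SLE_κ driving paths are continuous (every `ω`). [folklore] -/
theorem continuous_sleDriving' (κ : ℝ≥0) : ∀ ω : ℝ≥0 → ℝ, Continuous (sleDriving κ ω) :=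
  continuous_sleDriving κ

/-- **The level-`n` radial Bessel flow of SLE_κ** started at `θ`:
`Yₜ = θ + ∫₀ᵗ cotTrunc δₙ (Y_s/2) ds - √κ Bₜ` on the canonical space (`argLevel` for the driving path
`√κ B`); LSW's `Yₜ^θ` (2.9)–(2.11) / Lawler's (6.12)–(6.13) up to its exit from
`(2δₙ, 2π - 2δₙ)`. [cite: LawlerSchrammWernerEJP2002, §2 (2.9)–(2.11)] -/
abbrev sleArgLevel (κ : ℝ≥0) (n : ℕ) (θ : ℝ) : ℝ≥0 → (ℝ≥0 → ℝ) → ℝ :=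
  argLevel (sleDriving κ) (continuous_sleDriving' κ) n θ

/-- The exit time `σₙ` of the level-`n` SLE_κ radial Bessel flow from `(2δₙ, 2π - 2δₙ)`.
[folklore] -/
abbrev sleExitLevel (κ : ℝ≥0) (n : ℕ) (θ : ℝ) : (ℝ≥0 → ℝ) → WithTop ℝ≥0 :=
  exitLevel (sleDriving κ) (continuous_sleDriving' κ) n θ

variable {κ : ℝ≥0} {n : ℕ} {θ : ℝ}

/-- The SLE_κ driving path is adapted to the raw Brownian filtration, in the form consumed by
`RadialBesselFlow`/`RadialBesselExit`. [folklore] -/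
theorem measurable_sleDriving_filtration (κ : ℝ≥0) (s : ℝ≥0) :
    Measurable[brownianFiltration s] fun ω ↦ sleDriving κ ω s :=
  measurable_sleDriving_of_le κ le_rfl

/-- The integrated equation of the level-`n` SLE_κ flow: for every path and time,
`Yₜ = θ + ∫₀ᵗ cotTrunc δₙ (Y_s/2) ds - √κ Bₜ`. [cite: Lawler2005, §6.4 eq. (6.12)] -/
theorem sleArgLevel_eq_integral (κ : ℝ≥0) (n : ℕ) (θ : ℝ) (t : ℝ≥0) (ω : ℝ≥0 → ℝ) :
    sleArgLevel κ n θ t ω = θ +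
      (∫ s in (0 : ℝ)..t, cotTrunc (level n) (sleArgLevel κ n θ s.toNNReal ω / 2)) -
        Real.sqrt κ * brownian t ω := by
  have h := argTrunc_eq_integral (continuous_sleDriving' κ) (level_pos n) (level_le n) θ ω (t := t)
  rw [sleDriving_zero, sub_zero, sleDriving_apply] at h
  exact h

/-- The level-`n` SLE_κ flow has continuous paths. [folklore] -/
theorem continuous_sleArgLevel (κ : ℝ≥0) (n : ℕ) (θ : ℝ) (ω : ℝ≥0 → ℝ) :
    Continuous fun t ↦ sleArgLevel κ n θ t ω :=
  continuous_argTrunc (continuous_sleDriving' κ) (level_pos n) (level_le n) θ ω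

/-- The level-`n` SLE_κ flow is adapted to the raw Brownian filtration. [folklore] -/
theorem adapted_sleArgLevel (κ : ℝ≥0) (n : ℕ) (θ : ℝ) :
    Adapted brownianFiltration (sleArgLevel κ n θ) :=
  adapted_argTrunc (continuous_sleDriving' κ) (level_pos n) (level_le n)
    (measurable_sleDriving_filtration κ) θ

/-- The level-`n` SLE_κ flow is strongly adapted. [folklore] -/
theorem stronglyAdapted_sleArgLevel (κ : ℝ≥0) (n : ℕ) (θ : ℝ) :
    StronglyAdapted brownianFiltration (sleArgLevel κ n θ) := fun t ↦
  (adapted_sleArgLevel κ n θ t).stronglyMeasurable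

/-- The exit time `σₙ` is a stopping time of the raw Brownian filtration. [folklore] -/
theorem isStoppingTime_sleExitLevel (κ : ℝ≥0) (n : ℕ) (θ : ℝ) :
    IsStoppingTime brownianFiltration (sleExitLevel κ n θ) :=
  isStoppingTime_truncExit (continuous_sleDriving' κ) (level_pos n) (level_le n)
    (measurable_sleDriving_filtration κ) θ

/-- The stopped level-`n` flow has continuous paths. [folklore] -/
theorem continuous_stoppedProcess_sleArgLevel (κ : ℝ≥0) (n : ℕ) (θ : ℝ)
    (ρ : (ℝ≥0 → ℝ) → WithTop ℝ≥0) (ω : ℝ≥0 → ℝ) :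
    Continuous fun t ↦ stoppedProcess (sleArgLevel κ n θ) ρ t ω :=
  continuous_stoppedProcess_apply (continuous_sleArgLevel κ n θ ω) ρ

/-- The level-`n` flow stopped at a stopping time is strongly adapted. [folklore] -/
theorem stronglyAdapted_stoppedProcess_sleArgLevel (κ : ℝ≥0) (n : ℕ) (θ : ℝ)
    {ρ : (ℝ≥0 → ℝ) → WithTop ℝ≥0} (hρ : IsStoppingTime brownianFiltration ρ) :
    StronglyAdapted brownianFiltration (stoppedProcess (sleArgLevel κ n θ) ρ) :=
  ((stronglyAdapted_sleArgLevel κ n θ).isStronglyProgressive_of_continuous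
    (continuous_sleArgLevel κ n θ)).stronglyAdapted_stoppedProcess hρ

/-- The level-`n` flow stopped at a stopping time is progressively measurable. [folklore] -/
theorem isStronglyProgressive_stoppedProcess_sleArgLevel (κ : ℝ≥0) (n : ℕ) (θ : ℝ)
    {ρ : (ℝ≥0 → ℝ) → WithTop ℝ≥0} (hρ : IsStoppingTime brownianFiltration ρ) :
    IsStronglyProgressive brownianFiltration (stoppedProcess (sleArgLevel κ n θ) ρ) :=
  (stronglyAdapted_stoppedProcess_sleArgLevel κ n θ hρ).isStronglyProgressive_of_continuous
    (continuous_stoppedProcess_sleArgLevel κ n θ ρ)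

/-- **The flow stopped at its exit time stays in `[2δₙ, 2π - 2δₙ]`** (start inside; every path).
[folklore] -/
theorem stoppedProcess_sleArgLevel_mem_Icc (hθ : θ ∈ Ioo (2 * level n) (2 * Real.pi - 2 * level n))
    (t : ℝ≥0) (ω : ℝ≥0 → ℝ) :
    stoppedProcess (sleArgLevel κ n θ) (sleExitLevel κ n θ) t ω ∈
      Icc (2 * level n) (2 * Real.pi - 2 * level n) :=
  Process.stoppedProcess_exitTime_mem_Icc (continuous_sleArgLevel κ n θ ω)
    (by rw [show sleArgLevel κ n θ 0 ω = θ from argTrunc_zero _ _ _ θ ω]; exact hθ) t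

/-! ### The stopped flow is an Itô process -/

/-- **Pathwise integrated form of the stopped flow**: for any random time `ρ`, every `ω` and `t`,
with `V = Y^ρ`, `V_t = θ + ∫₀ᵗ 𝟙_{s ≤ ρ} cotTrunc δₙ (V_s/2) ds - √κ B_{t ∧ ρ}`.
[cite: Lawler2005, §6.4 eq. (6.12)] -/
theorem stoppedProcess_sleArgLevel_eq (κ : ℝ≥0) (n : ℕ) (θ : ℝ) (ρ : (ℝ≥0 → ℝ) → WithTop ℝ≥0)
    (ω : ℝ≥0 → ℝ) (t : ℝ≥0) :
    stoppedProcess (sleArgLevel κ n θ) ρ t ω =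
      θ + (∫ s in (0 : ℝ)..t, trunc ρ (fun s ω ↦ cotTrunc (level n)
        (stoppedProcess (sleArgLevel κ n θ) ρ s ω / 2)) s.toNNReal ω) +
      -Real.sqrt κ * brownian ((min (t : WithTop ℝ≥0) (ρ ω)).untopA) ω := by
  set u : ℝ≥0 := (min (t : WithTop ℝ≥0) (ρ ω)).untopA with hu
  have huρ : (u : WithTop ℝ≥0) ≤ ρ ω := coe_untopA_min_le t (ρ ω)
  have hint : (∫ s in (0 : ℝ)..t, trunc ρ (fun s ω ↦ cotTrunc (level n)
      (stoppedProcess (sleArgLevel κ n θ) ρ s ω / 2)) s.toNNReal ω) =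
      ∫ s in (0 : ℝ)..u, cotTrunc (level n) (sleArgLevel κ n θ s.toNNReal ω / 2) := by
    have h1 := timeIntegral_trunc (fun s ω ↦ cotTrunc (level n)
      (stoppedProcess (sleArgLevel κ n θ) ρ s ω / 2)) ρ t ω
    simp only [timeIntegral] at h1
    rw [h1]
    refine intervalIntegral.integral_congr fun s hs ↦ ?_
    rw [uIcc_of_le (NNReal.coe_nonneg _)] at hs
    have hsρ : (s.toNNReal : WithTop ℝ≥0) ≤ ρ ω :=
      (WithTop.coe_le_coe.2 (Real.toNNReal_le_iff_le_coe.2 hs.2)).trans huρ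
    simp only [stoppedProcess_eq_of_le hsρ]
  have hstop : stoppedProcess (sleArgLevel κ n θ) ρ t ω = sleArgLevel κ n θ u ω := rfl
  rw [hint, hstop, sleArgLevel_eq_integral κ n θ u ω]
  ring

/-- **The stopped radial Bessel flow of SLE_κ is an Itô process.** For a stopping time `ρ` of the
raw Brownian filtration, the level-`n` flow stopped at `ρ`, `V = Y^ρ`, is an Itô process driven
by the canonical Brownian motion with drift `𝟙_{s ≤ ρ} cotTrunc δₙ (V_s/2)` and diffusion
coefficient `𝟙_{s ≤ ρ} (-√κ)`: `V_t = θ + ∫₀ᵗ 𝟙_{s ≤ ρ} cotTrunc δₙ (V_s/2) ds + ∫₀ᵗ 𝟙_{s≤ρ}(-√κ) dB_s`.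
Pathwise this is the integrated equation (`stoppedProcess_sleArgLevel_eq`); the stochastic term
is the Itô integral of the truncated constant, indistinguishable from `-√κ B^ρ`
(`IsItoIntegral.ae_eq_stoppedProcess`, Revuz–Yor IV Prop. (2.5)). This is the SDE
`dYₜ = cot(Yₜ/2) dt - √κ dBₜ` of LSW (2002), (2.11) (Lawler (2005), (6.13): `dỸ = (a/2) cot(Ỹ/2) dt
+ dB̃` after `t ↦ t/κ`), with truncated drift, localised at `ρ`.
[cite: LawlerSchrammWernerEJP2002, §2 (2.11)] -/
theorem isItoProcess_stoppedProcess_sleArgLevel (κ : ℝ≥0) (n : ℕ) (θ : ℝ)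
    {ρ : (ℝ≥0 → ℝ) → WithTop ℝ≥0} (hρ : IsStoppingTime brownianFiltration ρ) :
    IsItoProcess (stoppedProcess (sleArgLevel κ n θ) ρ)
      (trunc ρ fun s ω ↦ cotTrunc (level n) (stoppedProcess (sleArgLevel κ n θ) ρ s ω / 2))
      (trunc ρ fun _ _ ↦ -Real.sqrt κ) brownian brownianFiltration preWienerMeasure := by
  haveI := isProbabilityMeasure_preWienerMeasure'
  set V := stoppedProcess (sleArgLevel κ n θ) ρ with hVdef
  have hρ' : ∀ t : ℝ≥0, MeasurableSet[brownianFiltration t] {ω | ρ ω < t} :=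
    fun t ↦ hρ.measurableSet_lt t
  have hVc : ∀ ω, Continuous fun s ↦ V s ω := fun ω ↦
    continuous_stoppedProcess_sleArgLevel κ n θ ρ ω
  refine ⟨ae_of_all _ fun ω t ↦ ?_, ?_⟩
  · -- the drift is locally integrable: it is continuous in time (and bounded)
    refine integrableOn_trunc ?_
    have hc : Continuous fun r : ℝ ↦ cotTrunc (level n) (V r.toNNReal ω / 2) :=
      (continuous_cotTrunc (level_pos n) (level_le n)).comp
        (((hVc ω).comp continuous_real_toNNReal).div_const _)
    exact hc.continuousOn.integrableOn_compact isCompact_Icc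
  · -- the Itô integral of the truncated constant
    have hσ : IsStronglyProgressive brownianFiltration
        (trunc ρ fun (_ : ℝ≥0) (_ : ℝ≥0 → ℝ) ↦ -Real.sqrt κ) :=
      isStronglyProgressive_trunc (isStronglyProgressive_const _ _) hρ'
    have hfin : ∀ t : ℝ≥0, ∫⁻ ω, (∫⁻ s in Set.Icc (0 : ℝ) t, ENNReal.ofReal
        ((trunc ρ (fun (_ : ℝ≥0) (_ : ℝ≥0 → ℝ) ↦ -Real.sqrt κ)) s.toNNReal ω ^ 2))
        ∂preWienerMeasure ≠ ∞ := by
      intro t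
      have hle : ∀ ω : ℝ≥0 → ℝ, (∫⁻ s in Set.Icc (0 : ℝ) t, ENNReal.ofReal
          ((trunc ρ (fun (_ : ℝ≥0) (_ : ℝ≥0 → ℝ) ↦ -Real.sqrt κ)) s.toNNReal ω ^ 2)) ≤
          ENNReal.ofReal κ * volume (Set.Icc (0 : ℝ) t) := by
        intro ω
        rw [← setLIntegral_const]
        refine lintegral_mono fun s ↦ ENNReal.ofReal_le_ofReal ?_
        rw [trunc_apply]
        split_ifs
        · rw [neg_sq, Real.sq_sqrt κ.coe_nonneg]
        · simp
      refine ne_top_of_le_ne_top ?_ (lintegral_mono hle)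
      rw [lintegral_const, measure_univ, mul_one, Real.volume_Icc, sub_zero]
      exact ENNReal.mul_ne_top ENNReal.ofReal_ne_top ENNReal.ofReal_ne_top
    obtain ⟨J, hJ, -, -⟩ := exists_isItoIntegral_of_sq_integrable hσ hfin
    have hJeq := IsItoIntegral.ae_eq_stoppedProcess martingale_brownian_holds
      martingale_brownian_sq_sub_holds memLp_two_brownian continuous_brownian
      (H := fun (_ : ℝ≥0) (_ : ℝ≥0 → ℝ) ↦ -Real.sqrt κ) measurable_const hρ'
      (isItoIntegral_const_brownian (-Real.sqrt κ)) hJ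
    refine ⟨J, hJ, ?_⟩
    filter_upwards [hJeq] with ω hω t
    have h0 : V 0 ω = θ := by
      simp only [hVdef]
      rw [stoppedProcess_eq_of_le (coe_zero_le_withTop _)]
      exact argTrunc_zero _ _ _ θ ω
    rw [hω t, h0]
    exact stoppedProcess_sleArgLevel_eq κ n θ ρ ω t

/-! ### Calculus of the separated solution `f(s, x) = e^{μ s} F(x)` -/

section Calculus

variable {F : ℝ → ℝ} (μ : ℝ)

/-- `f(s, x) = e^{μ s} F(x)` is `C²` jointly for `F ∈ C²`. [folklore] -/
theorem contDiff_expWeight (hF : ContDiff ℝ 2 F) :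
    ContDiff ℝ 2 (Function.uncurry fun (s : ℝ) (x : ℝ) ↦ Real.exp (μ * s) * F x) :=
  ((Real.contDiff_exp.comp (contDiff_const.mul contDiff_fst)).mul (hF.comp contDiff_snd))

/-- `∂ₛ (e^{μ s} F x) = μ e^{μ s} F x`. [folklore] -/
theorem deriv_expWeight_left (s x : ℝ) :
    deriv (fun r ↦ Real.exp (μ * r) * F x) s = μ * Real.exp (μ * s) * F x := by
  have h : HasDerivAt (fun r ↦ Real.exp (μ * r) * F x) (Real.exp (μ * s) * μ * F x) s := by
    have h1 : HasDerivAt (fun r ↦ μ * r) μ s := by simpa using (hasDerivAt_id s).const_mul μ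
    exact (h1.exp).mul_const (F x)
  rw [h.deriv]; ring

/-- `∂ₓ (e^{μ s} F x) = e^{μ s} F' x`. [folklore] -/
theorem deriv_expWeight_right (hF : ContDiff ℝ 2 F) (s x : ℝ) :
    deriv (fun y ↦ Real.exp (μ * s) * F y) x = Real.exp (μ * s) * deriv F x := by
  have hd : DifferentiableAt ℝ F x := (hF.differentiable (by norm_num)).differentiableAt
  exact deriv_const_mul _ hd

/-- `∂ₓₓ (e^{μ s} F x) = e^{μ s} F'' x`. [folklore] -/
theorem iteratedDeriv_two_expWeight_right (hF : ContDiff ℝ 2 F) (s x : ℝ) :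
    iteratedDeriv 2 (fun y ↦ Real.exp (μ * s) * F y) x = Real.exp (μ * s) * iteratedDeriv 2 F x := by
  have hd : ∀ y, DifferentiableAt ℝ F y := fun y ↦ (hF.differentiable (by norm_num)).differentiableAt
  have hF' : ContDiff ℝ (1 + 1) F := hF
  have hd' : DifferentiableAt ℝ (deriv F) x :=
    ((contDiff_succ_iff_deriv.1 hF').2.2.differentiable one_ne_zero).differentiableAt
  rw [iteratedDeriv_succ, iteratedDeriv_one, iteratedDeriv_succ, iteratedDeriv_one]
  have : deriv (fun y ↦ Real.exp (μ * s) * F y) = fun y ↦ Real.exp (μ * s) * deriv F y :=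
    funext fun y ↦ deriv_const_mul _ (hd y)
  rw [this, deriv_const_mul _ hd']

/-- `∫ᵤᵗ μ e^{μ s} ds = e^{μ t} - e^{μ u}`. [folklore] -/
theorem integral_mul_exp_mul (u t : ℝ) :
    ∫ s in u..t, μ * Real.exp (μ * s) = Real.exp (μ * t) - Real.exp (μ * u) := by
  have h : ∀ s ∈ uIcc u t, HasDerivAt (fun r ↦ Real.exp (μ * r)) (μ * Real.exp (μ * s)) s := by
    intro s _
    have h1 : HasDerivAt (fun r ↦ μ * r) μ s := by simpa using (hasDerivAt_id s).const_mul μ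
    simpa [mul_comm] using h1.exp
  exact intervalIntegral.integral_eq_sub_of_hasDerivAt h
    ((continuous_const.mul (Real.continuous_exp.comp (continuous_const.mul continuous_id))).intervalIntegrable _ _)

end Calculus

/-! ### The post-exit drift integrates out -/

/-- **The post-exit drift of `e^{μ t} F(V_t)` integrates to `F(V_t)(e^{μ t} - e^{μ (t ∧ ρ)})`**:
for a process `V` frozen from the random time `ρ` on (`V_s = V_{s ∧ ρ}`), every path satisfies
`∫₀ᵗ (1 - 𝟙_{s ≤ ρ}) μ e^{μ s} F(V_s) ds = F(V_t) (e^{μ t} - e^{μ (t ∧ ρ)})`. [folklore] -/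
theorem integral_postExit_drift {X : ℝ≥0 → (ℝ≥0 → ℝ) → ℝ} (ρ : (ℝ≥0 → ℝ) → WithTop ℝ≥0)
    (μ : ℝ) (F : ℝ → ℝ) (ω : ℝ≥0 → ℝ) (hXc : Continuous fun s ↦ stoppedProcess X ρ s ω)
    (hF : Continuous F) (t : ℝ≥0) :
    ∫ s in (0 : ℝ)..t, (μ * Real.exp (μ * s) * F (stoppedProcess X ρ s.toNNReal ω) -
        trunc ρ (fun s ω ↦ μ * Real.exp (μ * s) * F (stoppedProcess X ρ s ω)) s.toNNReal ω) =
      F (stoppedProcess X ρ t ω) * (Real.exp (μ * t) -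
        Real.exp (μ * ((min (t : WithTop ℝ≥0) (ρ ω)).untopA : ℝ≥0))) := by
  set V := stoppedProcess X ρ with hV
  set u : ℝ≥0 := (min (t : WithTop ℝ≥0) (ρ ω)).untopA with hu
  have huρ : (u : WithTop ℝ≥0) ≤ ρ ω := coe_untopA_min_le t (ρ ω)
  have hut : u ≤ t := untopA_min_le t (ρ ω)
  have hg : Continuous fun s : ℝ ↦ μ * Real.exp (μ * s) * F (V s.toNNReal ω) :=
    (continuous_const.mul (Real.continuous_exp.comp (continuous_const.mul continuous_id))).mul
      (hF.comp (hXc.comp continuous_real_toNNReal))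
  -- the truncated integral is the integral up to `u`
  have h1 : (∫ s in (0 : ℝ)..t, trunc ρ (fun s ω ↦ μ * Real.exp (μ * s) * F (V s ω)) s.toNNReal ω) =
      ∫ s in (0 : ℝ)..u, μ * Real.exp (μ * s) * F (V s.toNNReal ω) := by
    have h := timeIntegral_trunc (fun s ω ↦ μ * Real.exp (μ * s) * F (V s ω)) ρ t ω
    simp only [timeIntegral] at h
    rw [h]
    refine intervalIntegral.integral_congr fun s hs ↦ ?_
    rw [uIcc_of_le (NNReal.coe_nonneg _)] at hs
    simp only [Real.coe_toNNReal _ hs.1]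
  -- on `[u, t]` the process is frozen at `V t = V u`
  have hfrozen : ∀ s ∈ Icc (u : ℝ) t, F (V s.toNNReal ω) = F (V t ω) := by
    intro s hs
    have hsu : u ≤ s.toNNReal := by
      rw [← NNReal.coe_le_coe, Real.coe_toNNReal _ (u.coe_nonneg.trans hs.1)]; exact hs.1
    congr 1
    simp only [hV, stoppedProcess]
    congr 1
    -- both clocks equal `t ∧ ρ = u`
    have hmin_s : min ((s.toNNReal : ℝ≥0) : WithTop ℝ≥0) (ρ ω) = min (t : WithTop ℝ≥0) (ρ ω) := by
      have hst : ((s.toNNReal : ℝ≥0) : WithTop ℝ≥0) ≤ t :=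
        WithTop.coe_le_coe.2 ((Real.toNNReal_le_iff_le_coe).2 hs.2)
      apply le_antisymm
      · exact min_le_min hst le_rfl
      · rw [le_min_iff]
        refine ⟨?_, min_le_right _ _⟩
        calc min (t : WithTop ℝ≥0) (ρ ω) = u := (coe_untopA_min t (ρ ω)).symm
          _ ≤ s.toNNReal := WithTop.coe_le_coe.2 hsu
    rw [hmin_s]
  have hg' : Continuous fun r : ℝ ↦ μ * Real.exp (μ * (r.toNNReal : ℝ)) * F (V r.toNNReal ω) :=
    (continuous_const.mul (Real.continuous_exp.comp (continuous_const.mul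
      (NNReal.continuous_coe.comp continuous_real_toNNReal)))).mul
      (hF.comp (hXc.comp continuous_real_toNNReal))
  rw [intervalIntegral.integral_sub (hg.intervalIntegrable _ _) (by
      refine (integrableOn_trunc (S := Set.uIcc (0 : ℝ) t) ?_).intervalIntegrable
      exact (hg'.continuousOn.integrableOn_compact isCompact_uIcc)), h1,
    intervalIntegral.integral_interval_sub_left (hg.intervalIntegrable 0 t) (hg.intervalIntegrable 0 u)]
  have h2 : ∫ s in (u : ℝ)..t, μ * Real.exp (μ * s) * F (V s.toNNReal ω) =
      ∫ s in (u : ℝ)..t, μ * Real.exp (μ * s) * F (V t ω) := by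
    refine intervalIntegral.integral_congr fun s hs ↦ ?_
    rw [uIcc_of_le (by exact_mod_cast hut)] at hs
    simp only [hfrozen s hs]
  rw [h2, intervalIntegral.integral_mul_const, integral_mul_exp_mul]
  simp only [hV]
  ring


/-! ### The generator martingales with exponential weight -/

section Martingale

variable (κ n θ)

/-- The truncated, exponentially weighted generator drift
`D_s = 𝟙_{s ≤ σₙ} e^{μ s} (Λ_μ F)(V_s)` along the stopped level-`n` flow `V = Y^{σₙ}`. [folklore] -/
def genDrift (μ : ℝ) (F : ℝ → ℝ) : ℝ≥0 → (ℝ≥0 → ℝ) → ℝ :=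
  trunc (sleExitLevel κ n θ) fun s ω ↦ Real.exp (μ * s) *
    expGenerator κ μ F (stoppedProcess (sleArgLevel κ n θ) (sleExitLevel κ n θ) s ω)

/-- The exponential weight of the stopped clock, `e^{μ (t ∧ σₙ)}`. [folklore] -/
def expClock (μ : ℝ) (t : ℝ≥0) (ω : ℝ≥0 → ℝ) : ℝ :=
  Real.exp (μ * (((min (t : WithTop ℝ≥0) (sleExitLevel κ n θ ω)).untopA : ℝ≥0) : ℝ))

variable {κ n θ}

/-- Unfolding of `genDrift`. [folklore] -/
theorem genDrift_apply (μ : ℝ) (F : ℝ → ℝ) (s : ℝ≥0) (ω : ℝ≥0 → ℝ) :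
    genDrift κ n θ μ F s ω = trunc (sleExitLevel κ n θ) (fun s ω ↦ Real.exp (μ * s) *
      expGenerator κ μ F (stoppedProcess (sleArgLevel κ n θ) (sleExitLevel κ n θ) s ω)) s ω := rfl

/-- Unfolding of `expClock`. [folklore] -/
theorem expClock_apply (μ : ℝ) (t : ℝ≥0) (ω : ℝ≥0 → ℝ) :
    expClock κ n θ μ t ω =
      Real.exp (μ * (((min (t : WithTop ℝ≥0) (sleExitLevel κ n θ ω)).untopA : ℝ≥0) : ℝ)) := rfl

/-- `e^{μ (0 ∧ σ)} = 1`. [folklore] -/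
@[simp] theorem expClock_zero (μ : ℝ) (ω : ℝ≥0 → ℝ) : expClock κ n θ μ 0 ω = 1 := by
  rw [expClock_apply, untopA_min_zero]; simp

/-- The exponential weight is positive. [folklore] -/
theorem expClock_pos (μ : ℝ) (t : ℝ≥0) (ω : ℝ≥0 → ℝ) : 0 < expClock κ n θ μ t ω := Real.exp_pos _

/-- `e^{μ (t ∧ σ)} ≤ e^{|μ| t}`. [folklore] -/
theorem expClock_le (μ : ℝ) (t : ℝ≥0) (ω : ℝ≥0 → ℝ) : expClock κ n θ μ t ω ≤ Real.exp (|μ| * t) := by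
  rw [expClock_apply, Real.exp_le_exp]
  have h1 : (((min (t : WithTop ℝ≥0) (sleExitLevel κ n θ ω)).untopA : ℝ≥0) : ℝ) ≤ t := by
    exact_mod_cast untopA_min_le t (sleExitLevel κ n θ ω)
  have h0 : (0 : ℝ) ≤ ((min (t : WithTop ℝ≥0) (sleExitLevel κ n θ ω)).untopA : ℝ≥0) :=
    NNReal.coe_nonneg _
  calc μ * _ ≤ |μ| * (((min (t : WithTop ℝ≥0) (sleExitLevel κ n θ ω)).untopA : ℝ≥0) : ℝ) :=
        mul_le_mul_of_nonneg_right (le_abs_self μ) h0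
    _ ≤ |μ| * t := mul_le_mul_of_nonneg_left h1 (abs_nonneg μ)

/-- The stopped clock `t ∧ σₙ` is `𝓕ᵂ_t`-measurable. [folklore] -/
theorem measurable_untopA_min_sleExitLevel (κ : ℝ≥0) (n : ℕ) (θ : ℝ) (t : ℝ≥0) :
    Measurable[brownianFiltration t] fun ω ↦
      (min (t : WithTop ℝ≥0) (sleExitLevel κ n θ ω)).untopA := by
  have hst := (isStoppingTime_sleExitLevel κ n θ).min_const t
  have hmeas : Measurable[brownianFiltration t] fun ω ↦
      min (sleExitLevel κ n θ ω) (t : WithTop ℝ≥0) :=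
    hst.measurable_of_le fun ω ↦ min_le_right _ _
  have := hmeas.untopA
  simpa only [min_comm] using this

/-- The exponential weight is `𝓕ᵂ_t`-measurable. [folklore] -/
theorem measurable_expClock (μ : ℝ) (t : ℝ≥0) :
    Measurable[brownianFiltration t] (expClock κ n θ μ t) := by
  unfold expClock
  exact Real.measurable_exp.comp (measurable_const.mul
    (measurable_coe_nnreal_real.comp (measurable_untopA_min_sleExitLevel κ n θ t)))

/-- The generator drift is progressively measurable (`F ∈ C²`). [folklore] -/
theorem isStronglyProgressive_genDrift {F : ℝ → ℝ} (hF : ContDiff ℝ 2 F) (μ : ℝ) :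
    IsStronglyProgressive brownianFiltration (genDrift κ n θ μ F) := by
  have hσopt : ∀ t : ℝ≥0, MeasurableSet[brownianFiltration t] {ω | sleExitLevel κ n θ ω < t} :=
    fun t ↦ (isStoppingTime_sleExitLevel κ n θ).measurableSet_lt t
  refine isStronglyProgressive_trunc ?_ hσopt
  exact Literature.Analysis.FunctionSpaces.IsStronglyProgressive.comp_measurable₂
    (isStronglyProgressive_stoppedProcess_sleArgLevel κ n θ (isStoppingTime_sleExitLevel κ n θ))
    (F := fun s y ↦ Real.exp (μ * s) * expGenerator κ μ F y)
    ((Real.measurable_exp.comp (measurable_const.mul measurable_fst)).mul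
      ((measurable_expGenerator κ μ hF).comp measurable_snd))

/-- The time integral of the generator drift is `𝓕ᵂ_t`-measurable. [folklore] -/
theorem measurable_integral_genDrift {F : ℝ → ℝ} (hF : ContDiff ℝ 2 F) (μ : ℝ) (t : ℝ≥0) :
    Measurable[brownianFiltration t] fun ω ↦ ∫ s in (0 : ℝ)..t, genDrift κ n θ μ F s.toNNReal ω :=
  ((isStronglyProgressive_timeIntegral (isStronglyProgressive_genDrift hF μ)).stronglyAdapted
    t).measurable

/-- **The drift along the stopped flow is continuous in real time** (start inside): the weighted
generator of `F ∈ C²` composed with the continuous path `V`, which lives in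
`[2δₙ, 2π - 2δₙ] ⊆ (0, 2π)` where `cot(·/2)` is continuous. [folklore] -/
theorem continuous_expGenerator_comp (hθ : θ ∈ Ioo (2 * level n) (2 * Real.pi - 2 * level n))
    {F : ℝ → ℝ} (hF : ContDiff ℝ 2 F) (μ : ℝ) (ω : ℝ≥0 → ℝ) :
    Continuous fun r : ℝ ↦ Real.exp (μ * (r.toNNReal : ℝ)) * expGenerator κ μ F
      (stoppedProcess (sleArgLevel κ n θ) (sleExitLevel κ n θ) r.toNNReal ω) := by
  have hsub : Icc (2 * level n) (2 * Real.pi - 2 * level n) ⊆ Ioo 0 (2 * Real.pi) := by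
    intro y hy; have := level_pos n; exact ⟨by linarith [hy.1], by linarith [hy.2]⟩
  have hV : Continuous fun r : ℝ ↦ stoppedProcess (sleArgLevel κ n θ) (sleExitLevel κ n θ) r.toNNReal ω :=
    (continuous_stoppedProcess_sleArgLevel κ n θ _ ω).comp continuous_real_toNNReal
  refine (Real.continuous_exp.comp (continuous_const.mul
    (NNReal.continuous_coe.comp continuous_real_toNNReal))).mul ?_
  exact (continuousOn_expGenerator κ μ hF).comp_continuous hV fun r ↦
    hsub (stoppedProcess_sleArgLevel_mem_Icc hθ _ ω)

/-- The generator drift is integrable in time on every bounded interval (every path). [folklore] -/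
theorem intervalIntegrable_genDrift (hθ : θ ∈ Ioo (2 * level n) (2 * Real.pi - 2 * level n))
    {F : ℝ → ℝ} (hF : ContDiff ℝ 2 F) (μ : ℝ) (ω : ℝ≥0 → ℝ) (a b : ℝ) :
    IntervalIntegrable (fun s : ℝ ↦ genDrift κ n θ μ F s.toNNReal ω) volume a b := by
  refine (integrableOn_trunc (S := Set.uIcc a b) ?_).intervalIntegrable
  exact (continuous_expGenerator_comp hθ hF μ ω).continuousOn.integrableOn_compact isCompact_uIcc

/-- **The time integral of the generator drift is bounded** on `[0, t]`: by `t e^{|μ| t} C` with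
`C` a bound of `|Λ_μ F|` on `[2δₙ, 2π - 2δₙ]`. [folklore] -/
theorem abs_integral_genDrift_le (hθ : θ ∈ Ioo (2 * level n) (2 * Real.pi - 2 * level n))
    {F : ℝ → ℝ} (μ : ℝ) {C : ℝ}
    (hC : ∀ y ∈ Icc (2 * level n) (2 * Real.pi - 2 * level n), |expGenerator κ μ F y| ≤ C)
    (t : ℝ≥0) (ω : ℝ≥0 → ℝ) :
    |∫ s in (0 : ℝ)..t, genDrift κ n θ μ F s.toNNReal ω| ≤ t * (Real.exp (|μ| * t) * C) := by
  have hC0 : 0 ≤ C := (abs_nonneg _).trans (hC θ ⟨hθ.1.le, hθ.2.le⟩)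
  have hbound : ∀ s ∈ Set.uIoc (0 : ℝ) t, ‖genDrift κ n θ μ F s.toNNReal ω‖ ≤ Real.exp (|μ| * t) * C := by
    intro s hs
    rw [Set.uIoc_of_le t.coe_nonneg] at hs
    rw [Real.norm_eq_abs, genDrift_apply, trunc_apply]
    split_ifs with h
    · rw [abs_mul, Real.abs_exp]
      refine mul_le_mul (Real.exp_le_exp.2 ?_) (hC _ (stoppedProcess_sleArgLevel_mem_Icc hθ _ ω))
        (abs_nonneg _) (Real.exp_pos _).le
      have hs' : ((s.toNNReal : ℝ≥0) : ℝ) = s := Real.coe_toNNReal _ hs.1.le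
      rw [hs']
      calc μ * s ≤ |μ| * s := mul_le_mul_of_nonneg_right (le_abs_self μ) hs.1.le
        _ ≤ |μ| * t := mul_le_mul_of_nonneg_left hs.2 (abs_nonneg μ)
    · rw [abs_zero]; positivity
  have h := intervalIntegral.norm_integral_le_of_norm_le_const hbound
  rw [Real.norm_eq_abs] at h
  calc |∫ s in (0 : ℝ)..t, genDrift κ n θ μ F s.toNNReal ω| ≤ Real.exp (|μ| * t) * C * |(t : ℝ) - 0| := h
    _ = t * (Real.exp (|μ| * t) * C) := by rw [sub_zero, abs_of_nonneg t.coe_nonneg]; ring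

/-- **The generator martingales of the radial Bessel process with exponential weight** (the Itô
step of LSW (2002), proof of Lemma 2.2, p. 6, for separated solutions `e^{μ t} F(θ)`; Lawler
(2005), Lemma 1.31: "Itô's formula shows that `M_t := e^{λt} … φ₀(X_t)` is a martingale"). Let
`θ ∈ (2δₙ, 2π - 2δₙ)`, `V = Y^{σₙ}` the level-`n` SLE_κ radial Bessel flow stopped at its exit time
`σₙ` from `(2δₙ, 2π - 2δₙ)`, `F ∈ C²(ℝ)` and `μ ∈ ℝ`. Then
`e^{μ (t ∧ σₙ)} F(V_t) - ∫₀ᵗ 𝟙_{s ≤ σₙ} e^{μ s} ((κ/2) F'' + cot(·/2) F' + μ F)(V_s) ds`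
is a martingale for the raw Brownian filtration under the (pre-)Wiener measure. Proof: `V` is
the Itô process `θ + ∫ b ds + ∫ σ dB`, `b = 𝟙_{[0,σₙ]} cotTrunc δₙ (V/2) = 𝟙_{[0,σₙ]} cot(V/2)`,
`σ_s = -√κ 𝟙_{[0,σₙ]}` (`isItoProcess_stoppedProcess_sleArgLevel`); the tree's Itô formula
(`ito_formula_itoProcess_ae_of`) for `f(s, x) = e^{μ s} F(x)` gives a.s. for all `t`
`e^{μ t} F(V_t) = F(θ) + ∫₀ᵗ (𝟙_{s≤σₙ} e^{μs} Λ_μF(V_s) + 𝟙_{s>σₙ} μ e^{μs} F(V_s)) ds + K_t`,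
`K = ∫ σ_s e^{μ s} F'(V_s) dB_s` a martingale (bounded progressive integrand); since `V` is frozen
after `σₙ`, the post-exit drift integrates to `F(V_t)(e^{μt} - e^{μ(t∧σₙ)})`
(`integral_postExit_drift`) and the displayed process is the martingale `F(θ) + K`.
[cite: LawlerSchrammWernerEJP2002, §2 proof of Lemma 2.2 (p. 6)] -/
theorem martingale_expGenerator_sleArgLevel (hθ : θ ∈ Ioo (2 * level n) (2 * Real.pi - 2 * level n))
    {F : ℝ → ℝ} (hF : ContDiff ℝ 2 F) (μ : ℝ) :
    Martingale (fun t ω ↦ expClock κ n θ μ t ω *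
        F (stoppedProcess (sleArgLevel κ n θ) (sleExitLevel κ n θ) t ω) -
        ∫ s in (0 : ℝ)..t, genDrift κ n θ μ F s.toNNReal ω)
      brownianFiltration preWienerMeasure := by
  haveI := isProbabilityMeasure_preWienerMeasure'
  set X := sleArgLevel κ n θ with hX
  set σ := sleExitLevel κ n θ with hσ
  set V := stoppedProcess X σ with hV
  set b : ℝ≥0 → (ℝ≥0 → ℝ) → ℝ := trunc σ fun s ω ↦ cotTrunc (level n) (V s ω / 2) with hb
  set σ' : ℝ≥0 → (ℝ≥0 → ℝ) → ℝ := trunc σ fun _ _ ↦ -Real.sqrt κ with hσ'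
  have hσst : IsStoppingTime brownianFiltration σ := isStoppingTime_sleExitLevel κ n θ
  have hσopt : ∀ t : ℝ≥0, MeasurableSet[brownianFiltration t] {ω | σ ω < t} := fun t ↦
    hσst.measurableSet_lt t
  have hVito : IsItoProcess V b σ' brownian brownianFiltration preWienerMeasure :=
    isItoProcess_stoppedProcess_sleArgLevel κ n θ hσst
  have hVprog : IsStronglyProgressive brownianFiltration V :=
    isStronglyProgressive_stoppedProcess_sleArgLevel κ n θ hσst
  have hVadapt : Adapted brownianFiltration V := hVprog.stronglyAdapted.adapted
  have hσ'prog : IsStronglyProgressive brownianFiltration σ' :=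
    isStronglyProgressive_trunc (isStronglyProgressive_const _ _) hσopt
  have hVmem : ∀ t ω, V t ω ∈ Icc (2 * level n) (2 * Real.pi - 2 * level n) :=
    fun t ω ↦ stoppedProcess_sleArgLevel_mem_Icc hθ t ω
  have hVc : ∀ ω, Continuous fun t ↦ V t ω := fun ω ↦ continuous_stoppedProcess_sleArgLevel κ n θ σ ω
  have hV0 : ∀ ω, V 0 ω = θ := fun ω ↦ by
    simp only [hV]
    rw [stoppedProcess_eq_of_le (coe_zero_le_withTop _)]
    exact argTrunc_zero _ _ _ θ ω
  -- the separated solution `f(s, x) = e^{μ s} F(x)` and the integrand of the stochastic integral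
  set f : ℝ → ℝ → ℝ := fun s x ↦ Real.exp (μ * s) * F x with hf_def
  have hf : ContDiff ℝ 2 (Function.uncurry f) := contDiff_expWeight μ hF
  have hF' : Continuous (deriv F) := hF.continuous_deriv (by norm_num)
  obtain ⟨C, hC⟩ := (isCompact_Icc (a := 2 * level n) (b := 2 * Real.pi - 2 * level n)).exists_bound_of_continuousOn
    hF'.continuousOn
  set H : ℝ≥0 → (ℝ≥0 → ℝ) → ℝ := fun t ω ↦ σ' t ω * deriv (f t) (V t ω) with hH
  have hHeq : H = fun t ω ↦ σ' t ω * (Real.exp (μ * t) * deriv F (V t ω)) := by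
    funext t ω
    simp only [hH, hf_def, deriv_expWeight_right μ hF]
  have hHprog : IsStronglyProgressive brownianFiltration H := by
    rw [hHeq]
    exact hσ'prog.mul (Literature.Analysis.FunctionSpaces.IsStronglyProgressive.comp_measurable₂
      hVprog (F := fun s u ↦ Real.exp (μ * s) * deriv F u)
      ((Real.measurable_exp.comp (measurable_const.mul measurable_fst)).mul
        (hF'.measurable.comp measurable_snd)))
  have hHbound : ∀ (t : ℝ≥0) ω, (t : ℝ) ≤ t → |H t ω| ≤ Real.sqrt κ * (Real.exp (|μ| * t) * C) := by
    intro s ω _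
    rw [hHeq]
    simp only [abs_mul, Real.abs_exp]
    refine mul_le_mul (abs_trunc_neg_sqrt_le κ σ s ω) (mul_le_mul (Real.exp_le_exp.2 ?_) ?_
      (abs_nonneg _) (Real.exp_pos _).le) (by positivity) (Real.sqrt_nonneg _)
    · exact mul_le_mul_of_nonneg_right (le_abs_self μ) s.coe_nonneg
    · simpa only [Real.norm_eq_abs] using hC _ (hVmem s ω)
  have hfin : ∀ t : ℝ≥0, ∫⁻ ω, (∫⁻ s in Set.Icc (0 : ℝ) t, ENNReal.ofReal (H s.toNNReal ω ^ 2))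
      ∂preWienerMeasure ≠ ∞ := by
    intro t
    set M : ℝ := Real.sqrt κ * (Real.exp (|μ| * t) * C) with hM
    have hle : ∀ ω : ℝ≥0 → ℝ, (∫⁻ s in Set.Icc (0 : ℝ) t, ENNReal.ofReal (H s.toNNReal ω ^ 2)) ≤
        ENNReal.ofReal (M ^ 2) * volume (Set.Icc (0 : ℝ) t) := by
      intro ω
      rw [← setLIntegral_const]
      refine setLIntegral_mono measurable_const fun s hs ↦ ENNReal.ofReal_le_ofReal ?_
      have hst : ((s.toNNReal : ℝ≥0) : ℝ) ≤ t := by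
        rw [Real.coe_toNNReal _ hs.1]; exact hs.2
      have h1 : |H s.toNNReal ω| ≤ Real.sqrt κ * (Real.exp (|μ| * s.toNNReal) * C) :=
        hHbound s.toNNReal ω le_rfl
      have h2 : Real.sqrt κ * (Real.exp (|μ| * s.toNNReal) * C) ≤ M := by
        have hC0 : 0 ≤ C := (norm_nonneg _).trans (hC θ ⟨hθ.1.le, hθ.2.le⟩)
        refine mul_le_mul_of_nonneg_left (mul_le_mul_of_nonneg_right (Real.exp_le_exp.2
          (mul_le_mul_of_nonneg_left hst (abs_nonneg μ))) hC0) (Real.sqrt_nonneg _)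
      have h3 : |H s.toNNReal ω| ≤ M := h1.trans h2
      calc H s.toNNReal ω ^ 2 = |H s.toNNReal ω| ^ 2 := (sq_abs _).symm
        _ ≤ M ^ 2 := pow_le_pow_left₀ (abs_nonneg _) h3 2
    refine ne_top_of_le_ne_top ?_ (lintegral_mono hle)
    rw [lintegral_const, measure_univ, mul_one, Real.volume_Icc, sub_zero]
    exact ENNReal.mul_ne_top ENNReal.ofReal_ne_top ENNReal.ofReal_ne_top
  obtain ⟨K, hK, hKmart, -⟩ := exists_isItoIntegral_of_sq_integrable hHprog hfin
  -- Itô's formula along `V`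
  have hito : ∀ᵐ ω ∂preWienerMeasure, ∀ t : ℝ≥0,
      f t (V t ω) = f (0 : ℝ≥0) (V 0 ω) +
        (∫ s in (0 : ℝ)..t, (deriv (fun r ↦ f r (V s.toNNReal ω)) (s.toNNReal : ℝ) +
          b s.toNNReal ω * deriv (f (s.toNNReal : ℝ)) (V s.toNNReal ω) +
          2⁻¹ * σ' s.toNNReal ω ^ 2 * iteratedDeriv 2 (f (s.toNNReal : ℝ)) (V s.toNNReal ω))) + K t ω :=
    ito_formula_itoProcess_ae_of (f := f) hf hVadapt hσ'prog hVito hK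
  -- the Itô drift is the generator drift plus the post-exit drift
  have hintegrand : ∀ ω (s : ℝ), deriv (fun r ↦ f r (V s.toNNReal ω)) (s.toNNReal : ℝ) +
      b s.toNNReal ω * deriv (f (s.toNNReal : ℝ)) (V s.toNNReal ω) +
      2⁻¹ * σ' s.toNNReal ω ^ 2 * iteratedDeriv 2 (f (s.toNNReal : ℝ)) (V s.toNNReal ω) =
      genDrift κ n θ μ F s.toNNReal ω +
        (μ * Real.exp (μ * (s.toNNReal : ℝ)) * F (V s.toNNReal ω) -
          trunc σ (fun s ω ↦ μ * Real.exp (μ * s) * F (V s ω)) s.toNNReal ω) := by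
    intro ω s
    simp only [hf_def, deriv_expWeight_left, deriv_expWeight_right μ hF,
      iteratedDeriv_two_expWeight_right μ hF]
    rw [genDrift_apply, hb, hσ', trunc_apply, trunc_apply, trunc_apply, trunc_apply]
    split_ifs with h
    · have hmem := hVmem s.toNNReal ω
      have hhalf : V s.toNNReal ω / 2 ∈ Icc (level n) (Real.pi - level n) := by
        constructor <;> linarith [hmem.1, hmem.2]
      rw [cotTrunc_eq_cot hhalf, expGenerator_apply, neg_sq, Real.sq_sqrt κ.coe_nonneg]
      simp only [hV, hX, hσ]
      ring
    · simp only [hV, hX, hσ]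
      ring
  have hint_eq : ∀ ω (t : ℝ≥0), (∫ s in (0 : ℝ)..t,
      (deriv (fun r ↦ f r (V s.toNNReal ω)) (s.toNNReal : ℝ) +
        b s.toNNReal ω * deriv (f (s.toNNReal : ℝ)) (V s.toNNReal ω) +
        2⁻¹ * σ' s.toNNReal ω ^ 2 * iteratedDeriv 2 (f (s.toNNReal : ℝ)) (V s.toNNReal ω))) =
      (∫ s in (0 : ℝ)..t, genDrift κ n θ μ F s.toNNReal ω) +
        F (V t ω) * (Real.exp (μ * t) - expClock κ n θ μ t ω) := by
    intro ω t
    simp_rw [hintegrand ω]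
    have hpost := integral_postExit_drift (X := X) σ μ F ω (hVc ω) hF.continuous t
    have hg : Continuous fun s : ℝ ↦ μ * Real.exp (μ * s) * F (V s.toNNReal ω) :=
      (continuous_const.mul (Real.continuous_exp.comp (continuous_const.mul continuous_id))).mul
        (hF.continuous.comp ((hVc ω).comp continuous_real_toNNReal))
    have hg' : Continuous fun r : ℝ ↦ μ * Real.exp (μ * (r.toNNReal : ℝ)) * F (V r.toNNReal ω) :=
      (continuous_const.mul (Real.continuous_exp.comp (continuous_const.mul
        (NNReal.continuous_coe.comp continuous_real_toNNReal)))).mul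
        (hF.continuous.comp ((hVc ω).comp continuous_real_toNNReal))
    have hint2 : IntervalIntegrable (fun s : ℝ ↦ μ * Real.exp (μ * (s.toNNReal : ℝ)) * F (V s.toNNReal ω) -
        trunc σ (fun s ω ↦ μ * Real.exp (μ * s) * F (V s ω)) s.toNNReal ω) volume 0 t := by
      refine (hg.intervalIntegrable _ _).congr ?_ |>.sub ?_
      · intro s hs
        rw [Set.uIoc_of_le t.coe_nonneg] at hs
        simp only [Real.coe_toNNReal _ hs.1.le]
      · refine (integrableOn_trunc (S := Set.uIcc (0 : ℝ) t) ?_).intervalIntegrable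
        exact hg'.continuousOn.integrableOn_compact isCompact_uIcc
    rw [intervalIntegral.integral_add (intervalIntegrable_genDrift hθ hF μ ω 0 t) hint2]
    congr 1
    rw [expClock_apply, ← hpost]
    refine intervalIntegral.integral_congr fun s hs ↦ ?_
    rw [uIcc_of_le t.coe_nonneg] at hs
    simp only [Real.coe_toNNReal _ hs.1]
    rfl
  -- pathwise identity: the displayed process is `F(θ) + K`
  have hpath : ∀ᵐ ω ∂preWienerMeasure, ∀ t : ℝ≥0,
      expClock κ n θ μ t ω * F (V t ω) - (∫ s in (0 : ℝ)..t, genDrift κ n θ μ F s.toNNReal ω) =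
        F θ + K t ω := by
    filter_upwards [hito] with ω hω t
    have h := hω t
    rw [hint_eq ω t, hV0 ω] at h
    simp only [hf_def, NNReal.coe_zero, mul_zero, Real.exp_zero, one_mul] at h
    have : Real.exp (μ * t) * F (V t ω) = F θ + ((∫ s in (0 : ℝ)..t, genDrift κ n θ μ F s.toNNReal ω) +
        F (V t ω) * (Real.exp (μ * t) - expClock κ n θ μ t ω)) + K t ω := h
    linear_combination this
  -- `F(θ) + K` is a martingale, and so is its adapted modification
  have hN : Martingale (fun t ω ↦ F θ + K t ω) brownianFiltration preWienerMeasure :=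
    (martingale_const brownianFiltration preWienerMeasure (F θ)).add hKmart
  have hMadapt : StronglyAdapted brownianFiltration fun t ω ↦
      expClock κ n θ μ t ω * F (V t ω) - ∫ s in (0 : ℝ)..t, genDrift κ n θ μ F s.toNNReal ω := by
    intro t
    refine Measurable.stronglyMeasurable ?_
    exact ((measurable_expClock μ t).mul
      (hF.continuous.measurable.comp (hVprog.stronglyAdapted t).measurable)).sub
      (measurable_integral_genDrift hF μ t)
  refine ⟨hMadapt, fun s t hst ↦ ?_⟩
  have h1 : (fun ω ↦ expClock κ n θ μ t ω * F (V t ω) - ∫ r in (0 : ℝ)..t, genDrift κ n θ μ F r.toNNReal ω)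
      =ᵐ[preWienerMeasure] fun ω ↦ F θ + K t ω := hpath.mono fun ω hω ↦ hω t
  have h2 : (fun ω ↦ expClock κ n θ μ s ω * F (V s ω) - ∫ r in (0 : ℝ)..s, genDrift κ n θ μ F r.toNNReal ω)
      =ᵐ[preWienerMeasure] fun ω ↦ F θ + K s ω := hpath.mono fun ω hω ↦ hω s
  calc preWienerMeasure[fun ω ↦ expClock κ n θ μ t ω * F (V t ω) -
        ∫ r in (0 : ℝ)..t, genDrift κ n θ μ F r.toNNReal ω | brownianFiltration s]
      =ᵐ[preWienerMeasure] preWienerMeasure[fun ω ↦ F θ + K t ω | brownianFiltration s] :=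
        condExp_congr_ae h1
    _ =ᵐ[preWienerMeasure] fun ω ↦ F θ + K s ω := hN.condExp_ae_eq hst
    _ =ᵐ[preWienerMeasure] fun ω ↦ expClock κ n θ μ s ω * F (V s ω) -
        ∫ r in (0 : ℝ)..s, genDrift κ n θ μ F r.toNNReal ω := h2.symm

end Martingale

/-! ### Expectations: the optional-stopping identities at bounded times -/

/-- A measurable function bounded in absolute value is integrable for the (pre-)Wiener measure.
[folklore] -/
theorem integrable_of_abs_le {g : (ℝ≥0 → ℝ) → ℝ} (hg : Measurable g) {C : ℝ} (hC : ∀ ω, |g ω| ≤ C) :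
    Integrable g preWienerMeasure := by
  haveI := isProbabilityMeasure_preWienerMeasure'
  exact (integrable_const C).mono' hg.aestronglyMeasurable
    (ae_of_all _ fun ω ↦ by simpa [Real.norm_eq_abs] using hC ω)

/-- The weighted observable `e^{μ(t∧σₙ)} F(V_t)` is measurable. [folklore] -/
theorem measurable_expClock_mul {F : ℝ → ℝ} (hF : ContDiff ℝ 2 F) (μ : ℝ) (t : ℝ≥0) :
    Measurable fun ω ↦ expClock κ n θ μ t ω *
      F (stoppedProcess (sleArgLevel κ n θ) (sleExitLevel κ n θ) t ω) :=
  ((measurable_expClock μ t).mono (brownianFiltration.le t) le_rfl).mul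
    (hF.continuous.measurable.comp ((stronglyAdapted_stoppedProcess_sleArgLevel κ n θ
      (isStoppingTime_sleExitLevel κ n θ) t).measurable.mono (brownianFiltration.le t) le_rfl))

/-- The weighted observable is integrable (start inside). [folklore] -/
theorem integrable_expClock_mul (hθ : θ ∈ Ioo (2 * level n) (2 * Real.pi - 2 * level n))
    {F : ℝ → ℝ} (hF : ContDiff ℝ 2 F) (μ : ℝ) (t : ℝ≥0) :
    Integrable (fun ω ↦ expClock κ n θ μ t ω *
      F (stoppedProcess (sleArgLevel κ n θ) (sleExitLevel κ n θ) t ω)) preWienerMeasure := by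
  obtain ⟨C, hC⟩ := (isCompact_Icc (a := 2 * level n) (b := 2 * Real.pi - 2 * level n)).exists_bound_of_continuousOn
    hF.continuous.continuousOn
  refine integrable_of_abs_le (measurable_expClock_mul hF μ t) (C := Real.exp (|μ| * t) * C) fun ω ↦ ?_
  rw [abs_mul, abs_of_pos (expClock_pos μ t ω)]
  have hFle : |F (stoppedProcess (sleArgLevel κ n θ) (sleExitLevel κ n θ) t ω)| ≤ C := by
    simpa [Real.norm_eq_abs] using hC _ (stoppedProcess_sleArgLevel_mem_Icc hθ t ω)
  exact mul_le_mul (expClock_le μ t ω) hFle (abs_nonneg _) (Real.exp_pos _).le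

/-- The time-integrated generator drift is integrable (start inside). [folklore] -/
theorem integrable_integral_genDrift (hθ : θ ∈ Ioo (2 * level n) (2 * Real.pi - 2 * level n))
    {F : ℝ → ℝ} (hF : ContDiff ℝ 2 F) (μ : ℝ) (t : ℝ≥0) :
    Integrable (fun ω ↦ ∫ s in (0 : ℝ)..t, genDrift κ n θ μ F s.toNNReal ω) preWienerMeasure := by
  obtain ⟨C, hC⟩ := exists_bound_expGenerator κ μ hF (α := 2 * level n)
    (by have := level_pos n; positivity)
    (by have := level_pos n; linarith : 2 * Real.pi - 2 * level n < 2 * Real.pi)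
  exact integrable_of_abs_le ((measurable_integral_genDrift hF μ t).mono (brownianFiltration.le t)
    le_rfl) (abs_integral_genDrift_le hθ μ hC t)

/-- **Expectation form of the generator martingale** (optional stopping at the bounded time
`t ∧ σₙ`; Lawler (2005), Prop. 1.30 / Lemma 1.31 pattern): for `θ ∈ (2δₙ, 2π - 2δₙ)`, `F ∈ C²`,
`μ ∈ ℝ` and every `t`,
`E[e^{μ (t∧σₙ)} F(V_t)] = F(θ) + E[∫₀ᵗ 𝟙_{s≤σₙ} e^{μs} (Λ_μ F)(V_s) ds]`.
[cite: Lawler2005, §1.11 Lemma 1.31] -/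
theorem integral_expClock_mul_eq (hθ : θ ∈ Ioo (2 * level n) (2 * Real.pi - 2 * level n))
    {F : ℝ → ℝ} (hF : ContDiff ℝ 2 F) (μ : ℝ) (t : ℝ≥0) :
    ∫ ω, expClock κ n θ μ t ω * F (stoppedProcess (sleArgLevel κ n θ) (sleExitLevel κ n θ) t ω)
        ∂preWienerMeasure =
      F θ + ∫ ω, (∫ s in (0 : ℝ)..t, genDrift κ n θ μ F s.toNNReal ω) ∂preWienerMeasure := by
  haveI := isProbabilityMeasure_preWienerMeasure'
  have hM := martingale_expGenerator_sleArgLevel (κ := κ) hθ hF μ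
  have h := integral_eq_of_martingale hM t
  have h0 : (fun ω ↦ expClock κ n θ μ 0 ω *
      F (stoppedProcess (sleArgLevel κ n θ) (sleExitLevel κ n θ) 0 ω) -
      ∫ s in (0 : ℝ)..((0 : ℝ≥0) : ℝ), genDrift κ n θ μ F s.toNNReal ω) = fun _ ↦ F θ := by
    funext ω
    rw [expClock_zero, one_mul, NNReal.coe_zero, intervalIntegral.integral_same, sub_zero,
      stoppedProcess_eq_of_le (coe_zero_le_withTop _)]
    exact congrArg F (argTrunc_zero _ _ _ θ ω)
  rw [h0, integral_const, probReal_univ, one_smul,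
    integral_sub (integrable_expClock_mul hθ hF μ t) (integrable_integral_genDrift hθ hF μ t)] at h
  linarith

/-- **Eigenfunctions: `E[e^{μ(t∧σₙ)} F(V_t)] = F(θ)`** when `Λ_μ F = 0` on `[2δₙ, 2π - 2δₙ]`
(the martingale `e^{λ t} φ₀(X_t)` of Lawler (2005), Lemma 1.31, stopped at `t ∧ σₙ`; LSW's
`H(Yₜ, s - t)` with `ΛH = 0`, p. 7). [cite: Lawler2005, §1.11 Lemma 1.31] -/
theorem integral_expClock_mul_eq_self (hθ : θ ∈ Ioo (2 * level n) (2 * Real.pi - 2 * level n))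
    {F : ℝ → ℝ} (hF : ContDiff ℝ 2 F) {μ : ℝ}
    (hgen : ∀ y ∈ Icc (2 * level n) (2 * Real.pi - 2 * level n), expGenerator κ μ F y = 0) (t : ℝ≥0) :
    ∫ ω, expClock κ n θ μ t ω * F (stoppedProcess (sleArgLevel κ n θ) (sleExitLevel κ n θ) t ω)
        ∂preWienerMeasure = F θ := by
  rw [integral_expClock_mul_eq hθ hF μ t]
  have hzero : ∀ ω, (∫ s in (0 : ℝ)..t, genDrift κ n θ μ F s.toNNReal ω) = 0 := by
    intro ω
    refine (intervalIntegral.integral_congr (g := fun _ ↦ (0 : ℝ)) fun s _ ↦ ?_).trans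
      (by simp)
    simp only [genDrift_apply, trunc_apply]
    split_ifs
    · rw [hgen _ (stoppedProcess_sleArgLevel_mem_Icc hθ _ ω), mul_zero]
    · rfl
  simp [hzero]

/-- **Supersolutions: `E[e^{μ(t∧σₙ)} F(V_t)] ≤ F(θ)`** when `Λ_μ F ≤ 0` on `[2δₙ, 2π - 2δₙ]`.
[cite: Lawler2005, §1.11 Lemma 1.31] -/
theorem integral_expClock_mul_le_self (hθ : θ ∈ Ioo (2 * level n) (2 * Real.pi - 2 * level n))
    {F : ℝ → ℝ} (hF : ContDiff ℝ 2 F) {μ : ℝ}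
    (hgen : ∀ y ∈ Icc (2 * level n) (2 * Real.pi - 2 * level n), expGenerator κ μ F y ≤ 0) (t : ℝ≥0) :
    ∫ ω, expClock κ n θ μ t ω * F (stoppedProcess (sleArgLevel κ n θ) (sleExitLevel κ n θ) t ω)
        ∂preWienerMeasure ≤ F θ := by
  rw [integral_expClock_mul_eq hθ hF μ t]
  have hnonpos : ∀ ω, (∫ s in (0 : ℝ)..t, genDrift κ n θ μ F s.toNNReal ω) ≤ 0 := by
    intro ω
    have h := intervalIntegral.integral_mono_on t.coe_nonneg (intervalIntegrable_genDrift hθ hF μ ω 0 t)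
      (intervalIntegrable_const (c := (0 : ℝ))) fun s _ ↦ (show genDrift κ n θ μ F s.toNNReal ω ≤ 0 by
        simp only [genDrift_apply, trunc_apply]
        split_ifs
        · exact mul_nonpos_of_nonneg_of_nonpos (Real.exp_pos _).le
            (hgen _ (stoppedProcess_sleArgLevel_mem_Icc hθ _ ω))
        · exact le_rfl)
    simpa using h
  have := integral_nonpos (μ := preWienerMeasure) fun ω ↦ hnonpos ω
  linarith


end RadialLoewner

end Literature.Probability.RandomPlanarGeometry
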